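import Summits.AtomisticToContinuum.HydrodynamicLimit.Theorems.CollisionIsometryCLTAdaptedWeightCLTSustainedAnisotropy
import Summits.AtomisticToContinuum.HydrodynamicLimit.Theorems.CollisionIsometryCLTAdaptedWeightCLTCBEqRungStatics

/-!
# Stub `stub_scaleSplit` of the line `sustained-anisotropy-superexp` for the crux `AdaptedWeightCLT`
(stmt-AtomisticToContinuum-14868, rev-12 TIME-LOCAL form; `--supports`), helper file 1/2: the pointwise split

THE CHAOS-FREE SCALE SPLIT of the crux integrand over ONE BLOCK (pure algebra, every configuration `w`, every
`x`, nonnegative block weights `φᵢ = φ_N(xᵢ − x)`):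
`defectC N φ w x ≤ 2 · cellA N φ ψ w x + 1260 · ethC N φ ψ w x · reyC N φ ψ w x` (`defectC_le_split`,
registered anchor `scaleSplit_pointwise_anchor`).
Writing `vᵢ − ū = aᵢ + dᵢ` with `aᵢ = vᵢ − cvelᵢ` (velocity relative to the particle's own cell) and
`dᵢ = cvelᵢ − ū` (cell velocity relative to the block velocity), the Lipschitz bounds of the test pairings
(`Pointwise.abs_pairT_C2_sub_le`, `Pointwise.abs_pairT_C3_sub_le`) give
`|D_{jk} − A_{jk}| ≤ 4P + 2R₂`, `|q_a − Q_a| ≤ 6P' + 3P''` with the mixed block moments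
`P = n⁻¹Σφᵢ|aᵢ||dᵢ|`, `R₂ = n⁻¹Σφᵢ|dᵢ|²`, `P' = n⁻¹Σφᵢ|aᵢ|²|dᵢ|`, `P'' = n⁻¹Σφᵢ|dᵢ||dᵢ|²`, each of which carries a
factor of the cell-velocity fluctuation `dᵢ`; by the weighted Cauchy–Schwarz inequality their squares are
`≤ ethC · reyC`, whence `D_{jk}² ≤ 2 A_{jk}² + 80 · ethC · reyC`, `q_a² ≤ 2 Q_a² + 180 · ethC · reyC` and the split
(`9 · 80 + 3 · 180 = 1260`).
Also here: joint measurability of `cellA`, `ethC`, `reyC` in `(w, x)` for continuous kernels, and their sup bounds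
over one block in terms of a velocity bound and the kernel height (used along good orbits in file 2/2).
-/

namespace Summit.AtomisticToContinuum.HydrodynamicLimit.Theorems.SustainedAnisotropy

open scoped BigOperators Topology Classical MeasureTheory ENNReal InnerProductSpace
open Filter Set MeasureTheory
open Literature.Analysis.FluidPDE
open Summit.AtomisticToContinuum.HydrodynamicLimit.Theorems.ContactSourceDuhamel
open Summit.AtomisticToContinuum.HydrodynamicLimit.Theorems.ContactSourceDuhamel.TimeLocal
open Summit.AtomisticToContinuum.HydrodynamicLimit.Theorems.ContactBalance
open Literature.MathematicalPhysics.KineticTheory (hsDiameter localGibbsLaw empiricalDensityField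
  empiricalMomentumField ae_mem_good_localGibbsLaw)

noncomputable section

namespace ScaleSplit

/-! ## Scalar bookkeeping -/

/-- `D² ≤ 2A² + 4(α² + β²) X` when `|D − A| ≤ α u + β v` and `u², v² ≤ X`. -/
theorem sq_le_of_abs_sub_le {D A u v X α β : ℝ} (h : |D - A| ≤ α * u + β * v) (hu : u ^ 2 ≤ X)
    (hv : v ^ 2 ≤ X) : D ^ 2 ≤ 2 * A ^ 2 + 4 * (α ^ 2 * X) + 4 * (β ^ 2 * X) := by
  have h1 : (D - A) ^ 2 ≤ (α * u + β * v) ^ 2 := by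
    rw [← sq_abs (D - A)]
    exact pow_le_pow_left₀ (abs_nonneg _) h 2
  have h2 : (α * u + β * v) ^ 2 ≤ 2 * (α ^ 2 * u ^ 2) + 2 * (β ^ 2 * v ^ 2) := by
    nlinarith [sq_nonneg (α * u - β * v)]
  have h3 : D ^ 2 ≤ 2 * A ^ 2 + 2 * (D - A) ^ 2 := by nlinarith [sq_nonneg (D - 2 * A)]
  have h4 : α ^ 2 * u ^ 2 ≤ α ^ 2 * X := mul_le_mul_of_nonneg_left hu (sq_nonneg _)
  have h5 : β ^ 2 * v ^ 2 ≤ β ^ 2 * X := mul_le_mul_of_nonneg_left hv (sq_nonneg _)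
  linarith

/-- Rank-2 instance: `|D − A| ≤ 4u + 2v`, `u², v² ≤ X` give `D² ≤ 2A² + 80 X`. -/
theorem sq_le_rank2 {D A u v X : ℝ} (h : |D - A| ≤ 4 * u + 2 * v) (hu : u ^ 2 ≤ X)
    (hv : v ^ 2 ≤ X) : D ^ 2 ≤ 2 * A ^ 2 + 80 * X := by
  have h' := sq_le_of_abs_sub_le h hu hv
  linarith

/-- Rank-3 instance: `|D − A| ≤ 6u + 3v`, `u², v² ≤ X` give `D² ≤ 2A² + 180 X`. -/
theorem sq_le_rank3 {D A u v X : ℝ} (h : |D - A| ≤ 6 * u + 3 * v) (hu : u ^ 2 ≤ X)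
    (hv : v ^ 2 ≤ X) : D ^ 2 ≤ 2 * A ^ 2 + 180 * X := by
  have h' := sq_le_of_abs_sub_le h hu hv
  linarith

/-! ## Weighted sums over one block: Cauchy–Schwarz and the two Lipschitz channels -/

section Block

variable {ι : Type*} (s : Finset ι) {wt : ι → ℝ} {c : ℝ}

/-- Weighted Cauchy–Schwarz with monotone majorants:
`(c Σ wᵢ fᵢ gᵢ)² ≤ (c Σ wᵢ Fᵢ)(c Σ wᵢ Gᵢ)` for `wᵢ ≥ 0`, `fᵢ² ≤ Fᵢ`, `gᵢ² ≤ Gᵢ`. -/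
theorem wsum_mul_sq_le {f g F G : ι → ℝ} (hw : ∀ i ∈ s, 0 ≤ wt i) (hf : ∀ i ∈ s, f i ^ 2 ≤ F i)
    (hg : ∀ i ∈ s, g i ^ 2 ≤ G i) :
    (c * ∑ i ∈ s, wt i * (f i * g i)) ^ 2 ≤ (c * ∑ i ∈ s, wt i * F i) * (c * ∑ i ∈ s, wt i * G i) := by
  have hcs : (∑ i ∈ s, wt i * (f i * g i)) ^ 2 ≤
      (∑ i ∈ s, wt i * f i ^ 2) * ∑ i ∈ s, wt i * g i ^ 2 :=
    Finset.sum_sq_le_sum_mul_sum_of_sq_le_mul s (fun i hi => mul_nonneg (hw i hi) (sq_nonneg _))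
      (fun i hi => mul_nonneg (hw i hi) (sq_nonneg _)) (fun i _ => le_of_eq (by ring))
  have hF : ∑ i ∈ s, wt i * f i ^ 2 ≤ ∑ i ∈ s, wt i * F i :=
    Finset.sum_le_sum fun i hi => mul_le_mul_of_nonneg_left (hf i hi) (hw i hi)
  have hG : ∑ i ∈ s, wt i * g i ^ 2 ≤ ∑ i ∈ s, wt i * G i :=
    Finset.sum_le_sum fun i hi => mul_le_mul_of_nonneg_left (hg i hi) (hw i hi)
  have hF0 : 0 ≤ ∑ i ∈ s, wt i * f i ^ 2 := Finset.sum_nonneg fun i hi => mul_nonneg (hw i hi) (sq_nonneg _)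
  have hG0 : 0 ≤ ∑ i ∈ s, wt i * g i ^ 2 := Finset.sum_nonneg fun i hi => mul_nonneg (hw i hi) (sq_nonneg _)
  calc (c * ∑ i ∈ s, wt i * (f i * g i)) ^ 2 = c ^ 2 * (∑ i ∈ s, wt i * (f i * g i)) ^ 2 := by ring
    _ ≤ c ^ 2 * ((∑ i ∈ s, wt i * F i) * ∑ i ∈ s, wt i * G i) :=
        mul_le_mul_of_nonneg_left (hcs.trans (mul_le_mul hF hG hG0 (hF0.trans hF))) (sq_nonneg c)
    _ = (c * ∑ i ∈ s, wt i * F i) * (c * ∑ i ∈ s, wt i * G i) := by ring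

variable {a d : ι → V3}

/-- STRESS CHANNEL: replacing `aᵢ + dᵢ` by `aᵢ` in the weighted sum of `⟨C2 j k, y ⊗ y⟩` costs at most
`4 (c Σ wᵢ |aᵢ||dᵢ|) + 2 (c Σ wᵢ |dᵢ|²)`. -/
theorem abs_wsum_C2_sub_le (hc : 0 ≤ c) (hw : ∀ i ∈ s, 0 ≤ wt i) (j k : Fin 3) :
    |c * ∑ i ∈ s, wt i * pairT (C2 j k) (tpow 2 (a i + d i)) -
        c * ∑ i ∈ s, wt i * pairT (C2 j k) (tpow 2 (a i))| ≤
      4 * (c * ∑ i ∈ s, wt i * (‖a i‖ * ‖d i‖)) + 2 * (c * ∑ i ∈ s, wt i * (‖d i‖ * ‖d i‖)) := by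
  rw [← mul_sub, ← Finset.sum_sub_distrib, abs_mul, abs_of_nonneg hc]
  have e : 4 * (c * ∑ i ∈ s, wt i * (‖a i‖ * ‖d i‖)) + 2 * (c * ∑ i ∈ s, wt i * (‖d i‖ * ‖d i‖)) =
      c * ∑ i ∈ s, wt i * (4 * (‖a i‖ * ‖d i‖) + 2 * (‖d i‖ * ‖d i‖)) := by
    rw [Finset.mul_sum, Finset.mul_sum, Finset.mul_sum, Finset.mul_sum, Finset.mul_sum, ← Finset.sum_add_distrib]
    exact Finset.sum_congr rfl fun i _ => by ring
  rw [e]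
  refine mul_le_mul_of_nonneg_left ((Finset.abs_sum_le_sum_abs _ _).trans
    (Finset.sum_le_sum fun i hi => ?_)) hc
  rw [← mul_sub, abs_mul, abs_of_nonneg (hw i hi)]
  refine mul_le_mul_of_nonneg_left ?_ (hw i hi)
  have h := Pointwise.abs_pairT_C2_sub_le j k (a i) (a i + d i)
  rw [add_sub_cancel_left] at h
  refine h.trans ?_
  have hn : ‖a i + d i‖ ≤ ‖a i‖ + ‖d i‖ := norm_add_le _ _
  nlinarith [norm_nonneg (a i), norm_nonneg (d i)]

/-- HEAT-FLUX CHANNEL: replacing `aᵢ + dᵢ` by `aᵢ` in the weighted sum of `⟨C3 b, y^{⊗3}⟩` costs at most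
`6 (c Σ wᵢ |aᵢ|²|dᵢ|) + 3 (c Σ wᵢ |dᵢ| |dᵢ|²)`. -/
theorem abs_wsum_C3_sub_le (hc : 0 ≤ c) (hw : ∀ i ∈ s, 0 ≤ wt i) (b : Fin 3) :
    |c * ∑ i ∈ s, wt i * pairT (C3 b) (tpow 3 (a i + d i)) -
        c * ∑ i ∈ s, wt i * pairT (C3 b) (tpow 3 (a i))| ≤
      6 * (c * ∑ i ∈ s, wt i * (‖a i‖ ^ 2 * ‖d i‖)) + 3 * (c * ∑ i ∈ s, wt i * (‖d i‖ * ‖d i‖ ^ 2)) := by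
  rw [← mul_sub, ← Finset.sum_sub_distrib, abs_mul, abs_of_nonneg hc]
  have e : 6 * (c * ∑ i ∈ s, wt i * (‖a i‖ ^ 2 * ‖d i‖)) + 3 * (c * ∑ i ∈ s, wt i * (‖d i‖ * ‖d i‖ ^ 2)) =
      c * ∑ i ∈ s, wt i * (6 * (‖a i‖ ^ 2 * ‖d i‖) + 3 * (‖d i‖ * ‖d i‖ ^ 2)) := by
    rw [Finset.mul_sum, Finset.mul_sum, Finset.mul_sum, Finset.mul_sum, Finset.mul_sum, ← Finset.sum_add_distrib]
    exact Finset.sum_congr rfl fun i _ => by ring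
  rw [e]
  refine mul_le_mul_of_nonneg_left ((Finset.abs_sum_le_sum_abs _ _).trans
    (Finset.sum_le_sum fun i hi => ?_)) hc
  rw [← mul_sub, abs_mul, abs_of_nonneg (hw i hi)]
  refine mul_le_mul_of_nonneg_left ?_ (hw i hi)
  have h := Pointwise.abs_pairT_C3_sub_le b (a i) (a i + d i)
  rw [add_sub_cancel_left] at h
  refine h.trans ?_
  have hn : ‖a i + d i‖ + ‖a i‖ ≤ 2 * ‖a i‖ + ‖d i‖ := by linarith [norm_add_le (a i) (d i)]
  have h2 : (‖a i + d i‖ + ‖a i‖) ^ 2 ≤ (2 * ‖a i‖ + ‖d i‖) ^ 2 := pow_le_pow_left₀ (by positivity) hn 2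
  have h3 := mul_le_mul_of_nonneg_left h2 (norm_nonneg (d i))
  nlinarith [mul_nonneg (norm_nonneg (d i)) (sq_nonneg (‖a i‖ - ‖d i‖)), norm_nonneg (a i),
    norm_nonneg (d i)]

end Block

/-! ## The pointwise scale split over one block -/

section Split

variable {N : ℕ} {φ : ℕ → T3 → ℝ} (ψ : ℕ → T3 → ℝ) (w : Cfg N) (x : T3)

/-- Weighted Cauchy–Schwarz at configuration level: every moment product `(n⁻¹ Σ φᵢ fᵢ gᵢ)²` with
`fᵢ² ≤ 1 + |aᵢ|² + |aᵢ|⁴ + |dᵢ|²` and `gᵢ² ≤ |dᵢ|² + |dᵢ|⁴` is at most `ethC · reyC`. -/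
theorem csq_le (hφ0 : ∀ y, 0 ≤ φ N y) (f g : Fin (N + 1) → ℝ)
    (hf : ∀ i, f i ^ 2 ≤ 1 + ‖(w i).2 - cvel N ψ w i‖ ^ 2 + ‖(w i).2 - cvel N ψ w i‖ ^ 4 +
      ‖cvel N ψ w i - ubarC N φ w x‖ ^ 2)
    (hg : ∀ i, g i ^ 2 ≤ ‖cvel N ψ w i - ubarC N φ w x‖ ^ 2 + ‖cvel N ψ w i - ubarC N φ w x‖ ^ 4) :
    (((N + 1 : ℕ) : ℝ)⁻¹ * ∑ i, wgtC N φ w x i * (f i * g i)) ^ 2 ≤ ethC N φ ψ w x * reyC N φ ψ w x :=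
  wsum_mul_sq_le Finset.univ (wt := wgtC N φ w x) (fun _ _ => hφ0 _) (fun i _ => hf i) (fun i _ => hg i)

/-- Rank-2 entries of the split: `D_jk² ≤ 2 A_jk² + 80 · ethC · reyC`. -/
theorem blkC2_sq_le (hφ0 : ∀ y, 0 ≤ φ N y) (j k : Fin 3) :
    blkC 2 N φ w x (C2 j k) ^ 2 ≤
      2 * pecA 2 N φ ψ w x (C2 j k) ^ 2 + 80 * (ethC N φ ψ w x * reyC N φ ψ w x) := by
  have hc : (0 : ℝ) ≤ ((N + 1 : ℕ) : ℝ)⁻¹ := inv_nonneg.2 (Nat.cast_nonneg _)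
  have hw : ∀ i ∈ (Finset.univ : Finset (Fin (N + 1))), 0 ≤ wgtC N φ w x i := fun i _ => hφ0 _
  have h := abs_wsum_C2_sub_le Finset.univ (a := fun i => (w i).2 - cvel N ψ w i)
    (d := fun i => cvel N ψ w i - ubarC N φ w x) hc hw j k
  simp only [sub_add_sub_cancel] at h
  have hn := fun i => norm_nonneg ((w i).2 - cvel N ψ w i)
  have hd := fun i => norm_nonneg (cvel N ψ w i - ubarC N φ w x)
  refine sq_le_rank2 h (csq_le ψ w x hφ0 _ _ (fun i => ?_) (fun i => ?_))
    (csq_le ψ w x hφ0 _ _ (fun i => ?_) (fun i => ?_))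
  · nlinarith [hn i, hd i, sq_nonneg (‖(w i).2 - cvel N ψ w i‖ ^ 2)]
  · nlinarith [hd i, sq_nonneg (‖cvel N ψ w i - ubarC N φ w x‖ ^ 2)]
  · nlinarith [hn i, hd i, sq_nonneg (‖(w i).2 - cvel N ψ w i‖ ^ 2), sq_nonneg ‖(w i).2 - cvel N ψ w i‖]
  · nlinarith [hd i, sq_nonneg (‖cvel N ψ w i - ubarC N φ w x‖ ^ 2)]

/-- Rank-3 entries of the split: `q_a² ≤ 2 Q_a² + 180 · ethC · reyC`. -/
theorem blkC3_sq_le (hφ0 : ∀ y, 0 ≤ φ N y) (b : Fin 3) :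
    blkC 3 N φ w x (C3 b) ^ 2 ≤
      2 * pecA 3 N φ ψ w x (C3 b) ^ 2 + 180 * (ethC N φ ψ w x * reyC N φ ψ w x) := by
  have hc : (0 : ℝ) ≤ ((N + 1 : ℕ) : ℝ)⁻¹ := inv_nonneg.2 (Nat.cast_nonneg _)
  have hw : ∀ i ∈ (Finset.univ : Finset (Fin (N + 1))), 0 ≤ wgtC N φ w x i := fun i _ => hφ0 _
  have h := abs_wsum_C3_sub_le Finset.univ (a := fun i => (w i).2 - cvel N ψ w i)
    (d := fun i => cvel N ψ w i - ubarC N φ w x) hc hw b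
  simp only [sub_add_sub_cancel] at h
  have hn := fun i => norm_nonneg ((w i).2 - cvel N ψ w i)
  have hd := fun i => norm_nonneg (cvel N ψ w i - ubarC N φ w x)
  refine sq_le_rank3 h (csq_le ψ w x hφ0 _ _ (fun i => ?_) (fun i => ?_))
    (csq_le ψ w x hφ0 _ _ (fun i => ?_) (fun i => ?_))
  · have e : (‖(w i).2 - cvel N ψ w i‖ ^ 2) ^ 2 = ‖(w i).2 - cvel N ψ w i‖ ^ 4 := by ring
    rw [e]
    nlinarith [hn i, hd i, sq_nonneg ‖(w i).2 - cvel N ψ w i‖, sq_nonneg ‖cvel N ψ w i - ubarC N φ w x‖]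
  · nlinarith [hd i, sq_nonneg (‖cvel N ψ w i - ubarC N φ w x‖ ^ 2)]
  · nlinarith [hn i, hd i, sq_nonneg (‖(w i).2 - cvel N ψ w i‖ ^ 2), sq_nonneg ‖(w i).2 - cvel N ψ w i‖]
  · have e : (‖cvel N ψ w i - ubarC N φ w x‖ ^ 2) ^ 2 = ‖cvel N ψ w i - ubarC N φ w x‖ ^ 4 := by ring
    rw [e]
    nlinarith [hd i, sq_nonneg ‖cvel N ψ w i - ubarC N φ w x‖]

/-- THE POINTWISE SCALE SPLIT over one block: `defectC ≤ 2 · cellA + 1260 · ethC · reyC`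
(`9 · 80 + 3 · 180 = 1260`). -/
theorem defectC_le_split (hφ0 : ∀ y, 0 ≤ φ N y) :
    defectC N φ w x ≤ 2 * cellA N φ ψ w x + 1260 * (ethC N φ ψ w x * reyC N φ ψ w x) := by
  have h2 := fun j k => blkC2_sq_le ψ w x hφ0 j k
  have h3 := fun b => blkC3_sq_le ψ w x hφ0 b
  unfold defectC cellA
  simp only [Fin.sum_univ_three]
  linarith [h2 0 0, h2 0 1, h2 0 2, h2 1 0, h2 1 1, h2 1 2, h2 2 0, h2 2 1, h2 2 2, h3 0, h3 1, h3 2]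

end Split

/-! ## Measurability of the split functionals in the configuration -/

section Meas

variable {N : ℕ} {φ ψ : ℕ → T3 → ℝ}

/-- The cell velocity of particle `i` is measurable in the configuration (continuous cell kernel). -/
theorem measurable_cvel (hψc : Continuous (ψ N)) (i : Fin (N + 1)) :
    Measurable fun w : Cfg N => cvel N ψ w i :=
  ((EqRung.measurable_ubarC_prod hψc).comp
    (measurable_id.prodMk (Geometry.IsMeasurable.measurable_pos i)) :)

/-- The cell-relative block moments are jointly measurable in `(w, x)`. -/
theorem measurable_pecA_prod (hφc : Continuous (φ N)) (hψc : Continuous (ψ N)) {r : ℕ} (C : Tens r) :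
    Measurable fun q : Cfg N × T3 => pecA r N φ ψ q.1 q.2 C := by
  unfold pecA
  refine (Finset.measurable_sum _ fun i _ => ?_).const_mul _
  exact (EqRung.measurable_wgtC_prod hφc i).mul ((EqRung.continuous_pairT_tpow C).measurable.comp
    (((Geometry.IsMeasurable.measurable_vel i).comp measurable_fst).sub
      ((measurable_cvel hψc i).comp measurable_fst)))

/-- `cellA` is jointly measurable in `(w, x)`. -/
theorem measurable_cellA_prod (hφc : Continuous (φ N)) (hψc : Continuous (ψ N)) :
    Measurable fun q : Cfg N × T3 => cellA N φ ψ q.1 q.2 := by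
  unfold cellA
  exact (Finset.measurable_sum _ fun j _ => Finset.measurable_sum _ fun k _ =>
    (measurable_pecA_prod hφc hψc (C2 j k)).pow_const 2).add
    (Finset.measurable_sum _ fun a _ => (measurable_pecA_prod hφc hψc (C3 a)).pow_const 2)

/-- The two fluctuation sizes `|vᵢ − cvelᵢ|`, `|cvelᵢ − ū(x)|` are jointly measurable in `(w, x)`. -/
theorem measurable_norms_prod (hφc : Continuous (φ N)) (hψc : Continuous (ψ N)) (i : Fin (N + 1)) :
    (Measurable fun q : Cfg N × T3 => ‖(q.1 i).2 - cvel N ψ q.1 i‖) ∧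
      Measurable fun q : Cfg N × T3 => ‖cvel N ψ q.1 i - ubarC N φ q.1 q.2‖ :=
  ⟨(((Geometry.IsMeasurable.measurable_vel i).comp measurable_fst).sub
      ((measurable_cvel hψc i).comp measurable_fst)).norm,
    (((measurable_cvel hψc i).comp measurable_fst).sub (EqRung.measurable_ubarC_prod hφc)).norm⟩

/-- `ethC` is jointly measurable in `(w, x)`. -/
theorem measurable_ethC_prod (hφc : Continuous (φ N)) (hψc : Continuous (ψ N)) :
    Measurable fun q : Cfg N × T3 => ethC N φ ψ q.1 q.2 := by
  unfold ethC
  refine (Finset.measurable_sum _ fun i _ => ?_).const_mul _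
  obtain ⟨ha, hd⟩ := measurable_norms_prod hφc hψc i
  exact (EqRung.measurable_wgtC_prod hφc i).mul
    (((measurable_const.add (ha.pow_const 2)).add (ha.pow_const 4)).add (hd.pow_const 2))

/-- `reyC` is jointly measurable in `(w, x)`. -/
theorem measurable_reyC_prod (hφc : Continuous (φ N)) (hψc : Continuous (ψ N)) :
    Measurable fun q : Cfg N × T3 => reyC N φ ψ q.1 q.2 := by
  unfold reyC
  refine (Finset.measurable_sum _ fun i _ => ?_).const_mul _
  obtain ⟨-, hd⟩ := measurable_norms_prod hφc hψc i
  exact (EqRung.measurable_wgtC_prod hφc i).mul ((hd.pow_const 2).add (hd.pow_const 4))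

end Meas

/-! ## Sup bounds over one block -/

section Bounds

variable {N : ℕ} {φ : ℕ → T3 → ℝ} (ψ : ℕ → T3 → ℝ) (w : Cfg N) (x : T3) {V Cw : ℝ}

/-- Sup bound of a block average: `|n⁻¹ Σ φᵢ gᵢ| ≤ Cw · B` for `|φᵢ| ≤ Cw`, `|gᵢ| ≤ B`. -/
theorem abs_avg_wmul_le {wt g : Fin (N + 1) → ℝ} {B : ℝ} (hCw : 0 ≤ Cw) (hw : ∀ i, |wt i| ≤ Cw)
    (hg : ∀ i, |g i| ≤ B) : |((N + 1 : ℕ) : ℝ)⁻¹ * ∑ i, wt i * g i| ≤ Cw * B :=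
  Reduction.abs_avg_le _ fun i => by
    rw [abs_mul]
    exact mul_le_mul (hw i) (hg i) (abs_nonneg _) hCw

/-- Sup bounds of the split functionals over one block with velocities `|vᵢ| ≤ V` and weights
`0 ≤ φᵢ ≤ Cw` (cell and block velocities are weighted averages of the `vᵢ`, so all fluctuations are `≤ 2V`). -/
theorem abs_split_le (hψ0 : ∀ y, 0 ≤ ψ N y) (hφ0 : ∀ y, 0 ≤ φ N y) (hφC : ∀ y, φ N y ≤ Cw) (hV : 0 ≤ V)
    (hv : ∀ i, ‖(w i).2‖ ≤ V) :
    (∀ j k, |pecA 2 N φ ψ w x (C2 j k)| ≤ Cw * (2 * (2 * V) ^ 2)) ∧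
      (∀ b, |pecA 3 N φ ψ w x (C3 b)| ≤ Cw * (2 * V) ^ 3) ∧
      |ethC N φ ψ w x| ≤ Cw * (1 + (2 * V) ^ 2 + (2 * V) ^ 4 + (2 * V) ^ 2) ∧
      |reyC N φ ψ w x| ≤ Cw * ((2 * V) ^ 2 + (2 * V) ^ 4) := by
  have hCw : 0 ≤ Cw := (hφ0 0).trans (hφC 0)
  have hw : ∀ i, |wgtC N φ w x i| ≤ Cw := fun i => by
    rw [wgtC, abs_of_nonneg (hφ0 _)]
    exact hφC _
  have hc : ∀ i, ‖cvel N ψ w i‖ ≤ V := fun i => by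
    rw [cvel, Pointwise.ubarC_eq]
    exact (Pointwise.avg_smul_eq_and_norm_le Finset.univ (fun j _ => hψ0 _) (fun j _ => hv j) hV).2
  have hu : ‖ubarC N φ w x‖ ≤ V := by
    rw [Pointwise.ubarC_eq]
    exact (Pointwise.avg_smul_eq_and_norm_le Finset.univ (fun j _ => hφ0 _) (fun j _ => hv j) hV).2
  have ha : ∀ i, ‖(w i).2 - cvel N ψ w i‖ ≤ 2 * V := fun i =>
    (norm_sub_le _ _).trans (by linarith [hv i, hc i])
  have hd : ∀ i, ‖cvel N ψ w i - ubarC N φ w x‖ ≤ 2 * V := fun i =>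
    (norm_sub_le _ _).trans (by linarith [hu, hc i])
  have ha2 : ∀ i, ‖(w i).2 - cvel N ψ w i‖ ^ 2 ≤ (2 * V) ^ 2 := fun i =>
    pow_le_pow_left₀ (norm_nonneg _) (ha i) 2
  have ha4 : ∀ i, ‖(w i).2 - cvel N ψ w i‖ ^ 4 ≤ (2 * V) ^ 4 := fun i =>
    pow_le_pow_left₀ (norm_nonneg _) (ha i) 4
  have hd2 : ∀ i, ‖cvel N ψ w i - ubarC N φ w x‖ ^ 2 ≤ (2 * V) ^ 2 := fun i =>
    pow_le_pow_left₀ (norm_nonneg _) (hd i) 2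
  have hd4 : ∀ i, ‖cvel N ψ w i - ubarC N φ w x‖ ^ 4 ≤ (2 * V) ^ 4 := fun i =>
    pow_le_pow_left₀ (norm_nonneg _) (hd i) 4
  refine ⟨fun j k => abs_avg_wmul_le hCw hw fun i => ?_, fun b => abs_avg_wmul_le hCw hw fun i => ?_,
    abs_avg_wmul_le hCw hw fun i => ?_, abs_avg_wmul_le hCw hw fun i => ?_⟩
  · exact (Pointwise.abs_pairT_C2_le j k _).trans (by linarith [ha2 i])
  · exact (Pointwise.abs_pairT_C3_le b _).trans (pow_le_pow_left₀ (norm_nonneg _) (ha i) 3)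
  · rw [abs_of_nonneg (by positivity)]
    linarith [ha2 i, ha4 i, hd2 i]
  · rw [abs_of_nonneg (by positivity)]
    linarith [hd2 i, hd4 i]

end Bounds

end ScaleSplit

/-- Registered anchor of this helper file: THE POINTWISE SCALE SPLIT over one block
(`ScaleSplit.defectC_le_split`), `defectC ≤ 2 · cellA + 1260 · ethC · reyC` for nonnegative block weights. -/
theorem scaleSplit_pointwise_anchor : ∀ (N : ℕ) (φ ψ : ℕ → T3 → ℝ) (w : Cfg N) (x : T3),
    (∀ y, 0 ≤ φ N y) → defectC N φ w x ≤ 2 * cellA N φ ψ w x + 1260 * (ethC N φ ψ w x * reyC N φ ψ w x) :=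
  fun _ _ ψ w x hφ0 => ScaleSplit.defectC_le_split ψ w x hφ0

end

end Summit.AtomisticToContinuum.HydrodynamicLimit.Theorems.SustainedAnisotropy
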